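import Literature.AnabelianGeometry.AbsoluteAnabelian.AbsAnabProp121viiBrauerAgreement
import Literature.AnabelianGeometry.AbsoluteAnabelian.LocalBrauerGroupQmodZ
import Literature.AnabelianGeometry.AbsoluteAnabelian.LocalUnramifiedUnitsCohomology
import Literature.NumberTheory.GaloisRepresentations.LocalDualityTheorem
import HarnessLib

/-!
# The two kernel residue maps of `Br(K)` agree: print's unramified route `N3 ∘ N2⁻¹` equals
# `−inv_K` (Kummer route) on ALL of `Br(K) = H²(G_K, K̄ˣ)`

For a non-archimedean local field `K` of characteristic `0` the tree now holds TWO kernel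
constructions of the residue map of local class field theory on the Brauer group
`Br(K) = H²(G_K, K̄ˣ)`:

* the Kummer route `Prop121vii.brauerInvariantEquiv K : Br(K) ≃+ ℚ/ℤ` (`LocalBrauerGroupQmodZ.lean`:
  inverse of the `μ_{ℚ/ℤ}`-level Kummer isomorphism followed by the colimit of THE characterised
  level residue maps `invLevel`), and
* print's route N3 ∘ N2⁻¹ of the proof of [AbsAnab] Prop 1.2.1 (vii) (p. 11 l. 59 – p. 12 l. 2):
  inverse unramified inflation `H²(G_K, K̄ˣ) ⥲ H²(Gal(K^nr/K), (K^nr)ˣ)`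
  (`infUnramified_two_bijective`), valuation `H²(Gal(K^nr/K), (K^nr)ˣ) ⥲ H²(Gal(K^nr/K), ℤ)`
  (`cohomologyMap (unrValuationHom K) 2`, bijective: `cohomologyMap_unrValuationHom_two_bijective`),
  and `H²(Gal(K^nr/K), ℤ) ⥲ ℚ/ℤ` by Frobenius evaluation of the inverse Bockstein (`H2UnrEquivQModZ`).

This file proves they AGREE UP TO THE GLOBAL SIGN on every Brauer class
(`unrBrauerComposite_eq_neg_brauerInvariantEquiv`): every class is a Kummer image
(`exists_cohomologyMap_kummerι_eq`), on which the Kummer route is `inv_n/n`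
(`brauerInvariantEquiv_kummer`) and print's route is `−inv_n/n` (abc-iut-w5-d198's level agreement
`brauerComposite_eq_neg_invariantMap`, Serre XIV §1 Prop. 3, the sign being the tree's cup-product
ordering `μ_n × μ_n^∨(1)`).  Consequently print's route is an additive BIJECTION `Br(K) → ℚ/ℤ`
agreeing with `−inv_K` (`unrBrauerComposite_bijective`), closing [AbsTopIII] Prop 3.2 (i) rows
P32.i.L01–L05 and [FrdII] Thm 2.4 (ii) row L20 at the level of ONE map on `Br(K)`.
HONEST FRAMING: textbook local class field theory; nothing here bears on [IUTchIII] Cor. 3.12.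

## References
* [SerreLocalFields1979] J.-P. Serre, *Local Fields*, GTM 67 (1979), XIII §3, XIV §1 Prop. 3.
* [MochizukiAbsAnab2004] S. Mochizuki, *The absolute anabelian geometry of hyperbolic curves* (2004),
  Prop 1.2.1 (vii), proof p. 11–12.
-/

noncomputable section

open CategoryTheory Function
open Field IsNonarchimedeanLocalField ValuativeRel

universe u

namespace Literature.AnabelianGeometry.AbsoluteAnabelian

open Literature.NumberTheory.GaloisRepresentations
open Literature.NumberTheory.GaloisRepresentations.DiscreteGaloisModule
open _root_.TopRep _root_.ContRepresentation _root_.ContinuousCohomology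

namespace Prop121vii

variable (K : Type u) [Field K] [ValuativeRel K] [TopologicalSpace K] [IsNonarchimedeanLocalField K]
  [CharZero K]

/-- **Print's route `N3 ∘ N2⁻¹` equals `−inv_K` on all of `Br(K)`**: for every `z ∈ H²(G_K, K̄ˣ)` and
every arithmetic Frobenius `φ`, the Frobenius evaluation of the inverse Bockstein of the valuation of
the inverse unramified inflation of `z` is `−(brauerInvariantEquiv K z)` (the Kummer-route residue,
`inv_n/n` on Kummer images).  [cite: MochizukiAbsAnab2004, Prop 1.2.1 (vii) p.11]
[cite: SerreLocalFields1979, XIV §1 Prop. 3] -/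
theorem unrBrauerComposite_eq_neg_brauerInvariantEquiv {φF : absoluteGaloisGroup K}
    (hφF : IsFrobPow φF 1) (z : galoisCohomology (units K) 2) :
    H2UnrEquivQModZ hφF (cohomologyMap (unrValuationHom K) 2
      ((AddEquiv.ofBijective
          (ContinuousCohomology.map (ContinuousMonoidHom.quotientMk (galUnr K))
            (invariantsInclusion (galUnr K) (units K)) 2).hom
          (infUnramified_two_bijective K)).symm z)) =
      - QModZCoeff.mk (brauerInvariantEquiv K z) := by
  obtain ⟨n, x, rfl⟩ := exists_cohomologyMap_kummerι_eq z
  haveI : NeZero (n : ℕ) := ⟨n.ne_zero⟩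
  haveI : Finite (MuCarrier K (n : ℕ)) := finite_muCarrier K (n : ℕ)
  rw [brauerInvariantEquiv_kummer,
    brauerComposite_eq_neg_invariantMap K hφF (invLevel K (n : ℕ)) (isInvariantMap_invLevel K (n : ℕ)) x]
  rfl

/-- **Print's residue map `Br(K) → ℚ/ℤ` (route N3 ∘ N2⁻¹ of [AbsAnab] Prop 1.2.1 (vii)) is a bijection**
(each arrow is: `infUnramified_two_bijective`, `cohomologyMap_unrValuationHom_two_bijective`,
`H2UnrEquivQModZ`); by `unrBrauerComposite_eq_neg_brauerInvariantEquiv` it is `−inv_K`.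
[cite: MochizukiAbsAnab2004, Prop 1.2.1 (vii) p.11] -/
theorem unrBrauerComposite_bijective {φF : absoluteGaloisGroup K} (hφF : IsFrobPow φF 1) :
    Bijective fun z : galoisCohomology (units K) 2 =>
      H2UnrEquivQModZ hφF (cohomologyMap (unrValuationHom K) 2
        ((AddEquiv.ofBijective
            (ContinuousCohomology.map (ContinuousMonoidHom.quotientMk (galUnr K))
              (invariantsInclusion (galUnr K) (units K)) 2).hom
            (infUnramified_two_bijective K)).symm z)) :=
  (unrBrauerInvariant_bijective K hφF).comp
    (AddEquiv.ofBijective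
      (ContinuousCohomology.map (ContinuousMonoidHom.quotientMk (galUnr K))
        (invariantsInclusion (galUnr K) (units K)) 2).hom
      (infUnramified_two_bijective K)).symm.bijective

end Prop121vii

end Literature.AnabelianGeometry.AbsoluteAnabelian

end
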